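import Literature.MathematicalPhysics.QuantumFieldTheory.TorusChartVorticity
import HarnessLib

/-!
# Spin-wave lift domains: winding sectors of vortex-free real configurations on a charted torus

For an `XY`-type model on a charted discrete torus `Λ` (`TorusChart.lean`) the phase configurations are real
fields `φ : Λ → ℝ` read modulo `2π` (`angleOf φ`).  This file sets up the change of variables from vortex-free
configurations modulo `2π` to real fields in winding sectors, at the level of SETS (the measure-theoretic
identity of partition functions is `TorusChartSpinWaveIntegral.lean`):

* `IsVortexFree φ` — the reduced gradient field of `angleOf φ` is flat (equivalently all plaquette vorticities
  vanish, `isVortexFree_iff_vort_eq_zero`); invariant under `φ ↦ φ + 2π m`, `m : Λ → ℤ`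
  (`isVortexFree_add_zsmul`).
* `liftDom k` (winding sector `k : Fin d → ℤ`) — real fields `φ` with `φ 0 ∈ [0, 2π)` all of whose gradients
  corrected by the seam jumps, `d₀ φ + seam (2π k)`, lie in `(-π, π]`.  On `liftDom k` the reduced gradient field of
  `angleOf φ` IS `d₀ φ + seam (2π k)` (`redGrad_angleOf_of_mem_liftDom`), so these configurations are vortex-free
  with winding vector `2π k`; the sectors are pairwise disjoint (`disjoint_liftDom`) and bounded
  (`abs_le_of_mem_liftDom`).
* `lift φ`, `liftWind φ` — the **canonical lift** `prim (redGrad (angleOf φ)) + (φ 0 mod 2π)` and its integer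
  winding vector: for vortex-free `φ`, `lift φ ∈ liftDom (liftWind φ)` (`lift_mem_liftDom`) and `lift φ ≡ φ`
  pointwise modulo `2π` (`angleOf_lift`, `exists_lift_eq_add_zsmul`).
* **Uniqueness** (`eq_of_mem_liftDom_of_angleOf_eq`): two fields in lift domains with the same reduction modulo
  `2π` coincide (and lie in the same sector).  Hence `φ ↦ (liftWind φ, lift φ)` is a bijection from vortex-free
  configurations modulo `2π` onto `Σ_k liftDom k`, inverse to reduction modulo `2π` (`lift_eq_self_of_mem_liftDom`).
-/

namespace Literature.MathematicalPhysics.QuantumFieldTheory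

open scoped BigOperators

namespace TorusChart

open Real

/-! ## Real configurations modulo `2π` -/

section AngleOf

variable {Λ : Type*}

/-- The angle configuration of a real field: `φ` read modulo `2π` at every site. [folklore] -/
noncomputable def angleOf (φ : Λ → ℝ) : Λ → Real.Angle := fun x => (φ x : Real.Angle)

/-- Unfolding `angleOf`. [folklore] -/
@[simp] theorem angleOf_apply (φ : Λ → ℝ) (x : Λ) : angleOf φ x = (φ x : Real.Angle) := rfl

/-- Shifting a real field by `2π` times an integer field does not change it modulo `2π`. [folklore] -/
theorem angleOf_add_zsmul (φ : Λ → ℝ) (m : Λ → ℤ) : angleOf (fun x => φ x + m x • (2 * π)) = angleOf φ := by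
  funext x
  rw [angleOf_apply, angleOf_apply, Real.Angle.coe_add, Real.Angle.coe_zsmul, Real.Angle.coe_two_pi, zsmul_zero,
    add_zero]

/-- Two real fields agree modulo `2π` iff they differ by `2π` times an integer field. [folklore] -/
theorem angleOf_eq_angleOf_iff (φ ψ : Λ → ℝ) : angleOf φ = angleOf ψ ↔ ∃ m : Λ → ℤ, ∀ x, φ x = ψ x + m x • (2 * π) := by
  constructor
  · intro h
    have hx : ∀ x, ∃ k : ℤ, φ x - ψ x = 2 * π * k := fun x =>
      Real.Angle.angle_eq_iff_two_pi_dvd_sub.1 (by simpa using congr_fun h x)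
    choose m hm using hx
    exact ⟨m, fun x => by rw [zsmul_eq_mul, mul_comm, ← hm x, add_sub_cancel]⟩
  · rintro ⟨m, hm⟩
    rw [show φ = fun x => ψ x + m x • (2 * π) from funext hm]
    exact angleOf_add_zsmul ψ m

end AngleOf

variable {Λ : Type*} [AddCommGroup Λ] {d : ℕ} (F : TorusChart Λ d)

/-- A real field is **vortex-free** if the reduced gradient field of its angle configuration is flat.
[folklore] -/
def IsVortexFree (φ : Λ → ℝ) : Prop := F.IsFlat (F.redGrad (angleOf φ))

/-- Vortex-free ⇔ all plaquette vorticities vanish. [folklore] -/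
theorem isVortexFree_iff_vort_eq_zero (φ : Λ → ℝ) : F.IsVortexFree φ ↔ ∀ x i j, F.vort (angleOf φ) x i j = 0 :=
  isFlat_redGrad_iff_vort_eq_zero _

/-- Vortex-freeness only depends on the field modulo `2π`. [folklore] -/
theorem isVortexFree_add_zsmul (φ : Λ → ℝ) (m : Λ → ℤ) :
    F.IsVortexFree (fun x => φ x + m x • (2 * π)) ↔ F.IsVortexFree φ := by
  rw [IsVortexFree, IsVortexFree, angleOf_add_zsmul]

/-- Small reduced gradients imply vortex-freeness. [folklore] -/
theorem isVortexFree_of_abs_redGrad_lt {φ : Λ → ℝ} (h : ∀ x i, |F.redGrad (angleOf φ) x i| < π / 2) :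
    F.IsVortexFree φ :=
  isFlat_redGrad_of_abs_lt h

/-! ## Lift domains (winding sectors) -/

/-- The real seam tuple `2π k` of an integer winding vector `k`. [folklore] -/
noncomputable def twoPiSeam (k : Fin d → ℤ) : Fin d → ℝ := fun μ => k μ • (2 * π)

/-- Unfolding `twoPiSeam`. [folklore] -/
@[simp] theorem twoPiSeam_apply (k : Fin d → ℤ) (μ : Fin d) : twoPiSeam k μ = k μ • (2 * π) := rfl

/-- `twoPiSeam` is injective. [folklore] -/
theorem twoPiSeam_injective : Function.Injective (twoPiSeam (d := d)) := fun k k' h => by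
  funext μ
  have := congr_fun h μ
  rw [twoPiSeam_apply, twoPiSeam_apply, zsmul_eq_mul, zsmul_eq_mul] at this
  exact_mod_cast mul_right_cancel₀ Real.two_pi_pos.ne' this

/-- The **lift domain** of the winding sector `k`: real fields based in `[0, 2π)` at the origin whose gradients,
corrected by the seam jumps `2π k`, are principal values. [folklore] -/
def liftDom (k : Fin d → ℤ) : Set (Λ → ℝ) :=
  {φ | φ 0 ∈ Set.Ico 0 (2 * π) ∧ ∀ x i, F.d₀ φ x i + F.seam (twoPiSeam k) x i ∈ Set.Ioc (-π) π}

/-- Membership in a lift domain. [folklore] -/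
theorem mem_liftDom_iff (k : Fin d → ℤ) (φ : Λ → ℝ) :
    φ ∈ F.liftDom k ↔ φ 0 ∈ Set.Ico 0 (2 * π) ∧ ∀ x i, F.d₀ φ x i + F.seam (twoPiSeam k) x i ∈ Set.Ioc (-π) π :=
  Iff.rfl

/-- Modulo `2π` a seam cochain with tuple `2π k` vanishes. [folklore] -/
theorem coe_seam_twoPiSeam (k : Fin d → ℤ) (x : Λ) (i : Fin d) :
    ((F.seam (twoPiSeam k) x i : ℝ) : Real.Angle) = 0 := by
  rw [seam_apply]
  split_ifs
  · rw [twoPiSeam_apply, Real.Angle.coe_zsmul, Real.Angle.coe_two_pi, zsmul_zero]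
  · exact Real.Angle.coe_zero

variable {F} in
/-- **On a lift domain the reduced gradients are the corrected gradients**:
`redGrad (angleOf φ) = d₀ φ + seam (2π k)` for `φ ∈ liftDom k`. [folklore] -/
theorem redGrad_angleOf_of_mem_liftDom {k : Fin d → ℤ} {φ : Λ → ℝ} (h : φ ∈ F.liftDom k) :
    F.redGrad (angleOf φ) = F.d₀ φ + F.seam (twoPiSeam k) := by
  funext x i
  have hx := h.2 x i
  rw [redGrad_apply, angleOf_apply, angleOf_apply, ← Real.Angle.coe_sub, Pi.add_apply, Pi.add_apply]
  have : ((φ (x + F.gen i) - φ x : ℝ) : Real.Angle) =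
      ((F.d₀ φ x i + F.seam (twoPiSeam k) x i : ℝ) : Real.Angle) := by
    rw [Real.Angle.coe_add, coe_seam_twoPiSeam, add_zero, d₀_apply]
  rw [this, Real.Angle.toReal_coe_eq_self_iff.2 ⟨hx.1, hx.2⟩]

variable {F} in
/-- Fields in a lift domain are vortex-free. [folklore] -/
theorem isVortexFree_of_mem_liftDom {k : Fin d → ℤ} {φ : Λ → ℝ} (h : φ ∈ F.liftDom k) : F.IsVortexFree φ := by
  rw [IsVortexFree, redGrad_angleOf_of_mem_liftDom h]
  exact (F.isFlat_d₀ φ).add (F.isFlat_seam _)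

variable {F} in
/-- The winding vector of a field in the lift domain of sector `k` is `2π k`. [folklore] -/
theorem wind_redGrad_angleOf_of_mem_liftDom {k : Fin d → ℤ} {φ : Λ → ℝ} (h : φ ∈ F.liftDom k) :
    F.wind (F.redGrad (angleOf φ)) = twoPiSeam k := by
  rw [redGrad_angleOf_of_mem_liftDom h, wind_d₀_add_seam]

variable {F} in
/-- **Uniqueness of lifts.** Two fields in lift domains which agree modulo `2π` are equal, and their sectors
coincide. [folklore] -/
theorem eq_of_mem_liftDom_of_angleOf_eq {k k' : Fin d → ℤ} {φ φ' : Λ → ℝ} (h : φ ∈ F.liftDom k)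
    (h' : φ' ∈ F.liftDom k') (heq : angleOf φ = angleOf φ') : φ = φ' ∧ k = k' := by
  have hgrad : F.d₀ φ + F.seam (twoPiSeam k) = F.d₀ φ' + F.seam (twoPiSeam k') := by
    rw [← redGrad_angleOf_of_mem_liftDom h, ← redGrad_angleOf_of_mem_liftDom h', heq]
  obtain ⟨hw, hc⟩ := (F.d₀_add_seam_eq_d₀_add_seam_iff φ φ' (twoPiSeam k) (twoPiSeam k')).1 hgrad
  refine ⟨?_, twoPiSeam_injective hw⟩
  -- the constant `φ 0 - φ' 0` is a multiple of `2π` in `(-2π, 2π)`, hence zero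
  obtain ⟨m, hm⟩ := (angleOf_eq_angleOf_iff φ φ').1 heq
  have h0 := hm 0
  have hφ0 := h.1; have hφ'0 := h'.1
  rw [Set.mem_Ico] at hφ0 hφ'0
  have hπ : 0 < 2 * π := Real.two_pi_pos
  have hm0 : m 0 = 0 := by
    rw [zsmul_eq_mul] at h0
    have h1 : ((m 0 : ℤ) : ℝ) * (2 * π) < 1 * (2 * π) := by linarith
    have h2 : (-1 : ℝ) * (2 * π) < ((m 0 : ℤ) : ℝ) * (2 * π) := by linarith
    have h1' : ((m 0 : ℤ) : ℝ) < 1 := lt_of_mul_lt_mul_right h1 hπ.le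
    have h2' : (-1 : ℝ) < ((m 0 : ℤ) : ℝ) := lt_of_mul_lt_mul_right h2 hπ.le
    have : m 0 < 1 := by exact_mod_cast h1'
    have : -1 < m 0 := by exact_mod_cast h2'
    omega
  rw [hm0, zero_zsmul, add_zero] at h0
  funext x
  have := hc x
  rw [h0, sub_self, sub_eq_zero] at this
  exact this

/-- **The lift domains are pairwise disjoint.** [folklore] -/
theorem disjoint_liftDom {k k' : Fin d → ℤ} (hkk' : k ≠ k') : Disjoint (F.liftDom k) (F.liftDom k') :=
  Set.disjoint_left.2 fun _ h h' => hkk' (eq_of_mem_liftDom_of_angleOf_eq h h' rfl).2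

/-! ## The canonical lift -/

/-- The **integer winding vector** of a real configuration: `wind (redGrad (angleOf φ)) = 2π · liftWind φ`.
[folklore] -/
noncomputable def liftWind (φ : Λ → ℝ) : Fin d → ℤ := fun μ => round (F.wind (F.redGrad (angleOf φ)) μ / (2 * π))

/-- The winding vector of the reduced gradient field is `2π` times the integer winding vector. [folklore] -/
theorem wind_redGrad_angleOf (φ : Λ → ℝ) : F.wind (F.redGrad (angleOf φ)) = twoPiSeam (F.liftWind φ) := by
  funext μ
  obtain ⟨n, hn⟩ := F.exists_wind_redGrad_eq (angleOf φ) μ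
  have hπ : (2 * π) ≠ 0 := Real.two_pi_pos.ne'
  have hv : F.liftWind φ μ = n := by
    rw [liftWind, hn, zsmul_eq_mul, mul_div_cancel_right₀ _ hπ, round_intCast]
  rw [twoPiSeam_apply, hv, hn]

/-- **The canonical lift** of a real configuration: the axial primitive of the reduced gradient field of
`φ mod 2π`, based at the representative of `φ 0` in `[0, 2π)`. [folklore] -/
noncomputable def lift (φ : Λ → ℝ) : Λ → ℝ :=
  fun x => F.prim (F.redGrad (angleOf φ)) x + toIcoMod Real.two_pi_pos 0 (φ 0)

/-- The canonical lift at the origin is the representative of `φ 0` in `[0, 2π)`. [folklore] -/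
theorem lift_origin (φ : Λ → ℝ) : F.lift φ 0 = toIcoMod Real.two_pi_pos 0 (φ 0) := by
  rw [lift, prim_origin, zero_add]

/-- The canonical lift only depends on the field modulo `2π`. [folklore] -/
theorem lift_add_zsmul (φ : Λ → ℝ) (m : Λ → ℤ) : F.lift (fun x => φ x + m x • (2 * π)) = F.lift φ := by
  funext x
  rw [lift, lift, angleOf_add_zsmul, toIcoMod_add_zsmul]

/-- The integer winding vector only depends on the field modulo `2π`. [folklore] -/
theorem liftWind_add_zsmul (φ : Λ → ℝ) (m : Λ → ℤ) : F.liftWind (fun x => φ x + m x • (2 * π)) = F.liftWind φ := by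
  funext μ; rw [liftWind, liftWind, angleOf_add_zsmul]

variable {F} in
/-- **The canonical lift reduces to the configuration**: `lift φ ≡ φ (mod 2π)` at every site, for vortex-free
`φ`. [folklore] -/
theorem angleOf_lift {φ : Λ → ℝ} (hφ : F.IsVortexFree φ) : angleOf (F.lift φ) = angleOf φ := by
  funext x
  exact coe_prim_redGrad_add hφ (Real.Angle.coe_toIcoMod _ _) x

variable {F} in
/-- The canonical lift differs from the configuration by `2π` times an integer field. [folklore] -/
theorem exists_lift_eq_add_zsmul {φ : Λ → ℝ} (hφ : F.IsVortexFree φ) :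
    ∃ m : Λ → ℤ, ∀ x, F.lift φ x = φ x + m x • (2 * π) :=
  (angleOf_eq_angleOf_iff _ _).1 (angleOf_lift hφ)

variable {F} in
/-- The gradient of the canonical lift of a vortex-free configuration. [folklore] -/
theorem d₀_lift_add_seam {φ : Λ → ℝ} (hφ : F.IsVortexFree φ) :
    F.d₀ (F.lift φ) + F.seam (twoPiSeam (F.liftWind φ)) = F.redGrad (angleOf φ) := by
  rw [← wind_redGrad_angleOf]
  exact (redGrad_eq_d₀_prim_add_seam hφ _).symm

variable {F} in
/-- **The canonical lift of a vortex-free configuration lies in the lift domain of its winding sector.**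
[folklore] -/
theorem lift_mem_liftDom {φ : Λ → ℝ} (hφ : F.IsVortexFree φ) : F.lift φ ∈ F.liftDom (F.liftWind φ) := by
  refine ⟨?_, fun x i => ?_⟩
  · rw [lift_origin]; exact toIcoMod_mem_Ico' _ _
  · have h := congr_fun (congr_fun (d₀_lift_add_seam hφ) x) i
    rw [Pi.add_apply, Pi.add_apply] at h
    rw [h, redGrad_apply]
    exact ⟨Real.Angle.neg_pi_lt_toReal _, Real.Angle.toReal_le_pi _⟩

variable {F} in
/-- **Reduction modulo `2π` inverts the lift**: a field already in a lift domain is its own canonical lift, and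
its sector is its integer winding vector. [folklore] -/
theorem lift_eq_self_of_mem_liftDom {k : Fin d → ℤ} {φ : Λ → ℝ} (h : φ ∈ F.liftDom k) :
    F.lift φ = φ ∧ F.liftWind φ = k :=
  eq_of_mem_liftDom_of_angleOf_eq (lift_mem_liftDom (isVortexFree_of_mem_liftDom h)) h
    (angleOf_lift (isVortexFree_of_mem_liftDom h))

variable {F} in
/-- **Every vortex-free configuration has exactly one `2πℤ^Λ`-translate in the union of the lift domains**,
namely its canonical lift. [folklore] -/
theorem existsUnique_zsmul_add_mem_liftDom {φ : Λ → ℝ} (hφ : F.IsVortexFree φ) :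
    ∃! m : Λ → ℤ, ∃ k : Fin d → ℤ, (fun x => φ x + m x • (2 * π)) ∈ F.liftDom k := by
  obtain ⟨m, hm⟩ := exists_lift_eq_add_zsmul hφ
  refine ⟨m, ⟨F.liftWind φ, ?_⟩, ?_⟩
  · rw [show (fun x => φ x + m x • (2 * π)) = F.lift φ from (funext hm).symm]
    exact lift_mem_liftDom hφ
  · rintro m' ⟨k', hk'⟩
    have h1 : (fun x => φ x + m' x • (2 * π)) = F.lift φ := by
      have := (eq_of_mem_liftDom_of_angleOf_eq hk' (lift_mem_liftDom hφ)
        (by rw [angleOf_add_zsmul, angleOf_lift hφ])).1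
      exact this
    funext x
    have hx := congr_fun h1 x
    rw [hm x, add_right_inj] at hx
    have : ((m' x : ℤ) : ℝ) * (2 * π) = (m x : ℝ) * (2 * π) := by rwa [zsmul_eq_mul, zsmul_eq_mul] at hx
    exact_mod_cast mul_right_cancel₀ Real.two_pi_pos.ne' this

/-! ## Bounds -/

/-- A line sum of a bounded cochain is bounded by the number of edges times the bound. [folklore] -/
theorem abs_lineSum_le {θ : Λ → Fin d → ℝ} {B : ℝ} (hB : ∀ y i, |θ y i| ≤ B) (i : Fin d) (n : ℕ) (y : Λ) :
    |F.lineSum θ i n y| ≤ n * B := by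
  rw [lineSum]
  calc |∑ k ∈ Finset.range n, θ (y + k • F.gen i) i| ≤ ∑ k ∈ Finset.range n, |θ (y + k • F.gen i) i| :=
        Finset.abs_sum_le_sum_abs _ _
    _ ≤ ∑ _k ∈ Finset.range n, B := Finset.sum_le_sum fun k _ => hB _ _
    _ = n * B := by rw [Finset.sum_const, Finset.card_range, nsmul_eq_mul]

/-- The staircase sums of a bounded cochain are bounded by the number of edges traversed times the bound.
[folklore] -/
theorem abs_axPrim_le {θ : Λ → Fin d → ℝ} {B : ℝ} (hB : ∀ y i, |θ y i| ≤ B) (x : Λ) :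
    ∀ k, |F.axPrim θ x k| ≤ (∑ i ∈ Finset.univ.filter (fun i : Fin d => (i : ℕ) < k), (F.period i : ℝ)) * B
  | 0 => by simp
  | k + 1 => by
    rw [axPrim_succ]
    by_cases hk : k < d
    · have hBk : 0 ≤ B := le_trans (abs_nonneg _) (hB x ⟨k, hk⟩)
      have hsplit : Finset.univ.filter (fun i : Fin d => (i : ℕ) < k + 1) =
          insert ⟨k, hk⟩ (Finset.univ.filter (fun i : Fin d => (i : ℕ) < k)) := by
        ext j
        simp only [Finset.mem_filter, Finset.mem_univ, true_and, Finset.mem_insert, Fin.ext_iff]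
        omega
      have hnot : (⟨k, hk⟩ : Fin d) ∉ Finset.univ.filter (fun i : Fin d => (i : ℕ) < k) := by simp
      rw [dif_pos hk, hsplit, Finset.sum_insert hnot, add_mul, add_comm ((F.period ⟨k, hk⟩ : ℝ) * B)]
      refine le_trans (abs_add_le _ _) (add_le_add (abs_axPrim_le hB x k) ?_)
      refine le_trans (F.abs_lineSum_le hB _ _ _) ?_
      exact mul_le_mul_of_nonneg_right (by exact_mod_cast (F.cval_lt ⟨k, hk⟩ x).le) hBk
    · have hsame : Finset.univ.filter (fun i : Fin d => (i : ℕ) < k + 1) =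
          Finset.univ.filter (fun i : Fin d => (i : ℕ) < k) := by
        ext j
        simp only [Finset.mem_filter, Finset.mem_univ, true_and]
        have := j.isLt
        omega
      rw [dif_neg hk, add_zero, hsame]
      exact abs_axPrim_le hB x k

/-- The axial primitive of a bounded cochain is bounded by the total number of staircase edges times the bound:
`|prim θ x| ≤ (Σ_i N_i) · B`. [folklore] -/
theorem abs_prim_le {θ : Λ → Fin d → ℝ} {B : ℝ} (hB : ∀ y i, |θ y i| ≤ B) (x : Λ) :
    |F.prim θ x| ≤ (∑ i, (F.period i : ℝ)) * B := by
  have h := F.abs_axPrim_le hB x d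
  rwa [Finset.filter_true_of_mem (fun i _ => i.isLt)] at h

variable {F} in
/-- Gradients of fields in the lift domain of sector `k` are bounded by `π + 2π Σ_μ |k_μ|`. [folklore] -/
theorem abs_d₀_le_of_mem_liftDom {k : Fin d → ℤ} {φ : Λ → ℝ} (h : φ ∈ F.liftDom k) (x : Λ) (i : Fin d) :
    |F.d₀ φ x i| ≤ π + 2 * π * ∑ μ, |(k μ : ℝ)| := by
  have hx := h.2 x i
  have h1 : |F.d₀ φ x i + F.seam (twoPiSeam k) x i| ≤ π := abs_le.2 ⟨hx.1.le, hx.2⟩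
  have h2 : |F.seam (twoPiSeam k) x i| ≤ 2 * π * ∑ μ, |(k μ : ℝ)| := by
    rw [seam_apply]
    have hπ : 0 ≤ 2 * π := Real.two_pi_pos.le
    have hsum : 0 ≤ ∑ μ, |(k μ : ℝ)| := Finset.sum_nonneg fun μ _ => abs_nonneg _
    split_ifs
    · rw [twoPiSeam_apply, zsmul_eq_mul, abs_mul, abs_of_nonneg hπ, mul_comm]
      exact mul_le_mul_of_nonneg_left (Finset.single_le_sum (fun μ _ => abs_nonneg ((k μ : ℝ))) (Finset.mem_univ i)) hπ
    · rw [abs_zero]; exact mul_nonneg hπ hsum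
  calc |F.d₀ φ x i| = |(F.d₀ φ x i + F.seam (twoPiSeam k) x i) - F.seam (twoPiSeam k) x i| := by rw [add_sub_cancel_right]
    _ ≤ |F.d₀ φ x i + F.seam (twoPiSeam k) x i| + |F.seam (twoPiSeam k) x i| := abs_sub _ _
    _ ≤ π + 2 * π * ∑ μ, |(k μ : ℝ)| := add_le_add h1 h2

variable {F} in
/-- **Lift domains are bounded**: `|φ x| ≤ 2π + (Σ_i N_i)(π + 2π Σ_μ |k_μ|)` on `liftDom k`. [folklore] -/
theorem abs_le_of_mem_liftDom {k : Fin d → ℤ} {φ : Λ → ℝ} (h : φ ∈ F.liftDom k) (x : Λ) :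
    |φ x| ≤ 2 * π + (∑ i, (F.period i : ℝ)) * (π + 2 * π * ∑ μ, |(k μ : ℝ)|) := by
  have hprim := F.abs_prim_le (abs_d₀_le_of_mem_liftDom h) x
  rw [prim_d₀] at hprim
  have h0 : |φ 0| ≤ 2 * π := by
    have := h.1; rw [Set.mem_Ico] at this
    exact abs_le.2 ⟨by linarith [Real.two_pi_pos], this.2.le⟩
  calc |φ x| = |φ 0 + (φ x - φ 0)| := by rw [add_sub_cancel]
    _ ≤ |φ 0| + |φ x - φ 0| := abs_add_le _ _
    _ ≤ _ := add_le_add h0 hprim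

end TorusChart

end Literature.MathematicalPhysics.QuantumFieldTheory
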